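import Summits.Ventures.HodgeRepro2.T5InertDegreePrinted

/-!
# The Cartan invariant at an inert place: `g ∈ K aₙ K ⟺ ϖⁿ clears `g` and `ϖ^{n−1}` does not
(cell pub-hodge-repro2, seat p3)

Tier-5 N3 support, towards the one sentence the Satake chain of files 186–208 still owes to print
(T5-SATAKE-KERNEL-p3.md row 12, the normalisation `T₁ ↦ q²(X + X⁻¹) + (q − 1)` of the Satake transform): the
transform is a finite count of unipotent cosets `n N(R)` with `a_m n ∈ K a₁ K`, so membership in a double coset
`K aₙ K` has to be DECIDED from the matrix. Seat p8's T5-134 / T5-136 / T5-187 give the two halves — every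
`g ∈ U(J₃(u))` lies in some `K a_m K` (`exists_mem_orbit_cellU`), `ϖ^m` clears every element of `K a_m K`
(`clears_pow_of_mem_orbit_cellU`), and `ϖ^l` clears an element of `K a_m K` only when `m ≤ l`
(`le_of_clears_pow_of_mem_orbit_cellU`). This file assembles them:

* `clears_zpow_mono` — `ϖ^l` clears `g` ⇒ `ϖ^{l'}` clears `g` for `l ≤ l'`;
* **`mem_orbit_cellU_iff`** — `g ∈ K aₙ K ⟺ ϖⁿ clears g ∧ ∀ l < n, ¬ ϖ^l clears g`;
* **`mem_orbit_cellU_succ_iff`** — `g ∈ K a_{n+1} K ⟺ ϖ^{n+1} clears g ∧ ¬ ϖⁿ clears g`;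
* `mem_orbit_cellU_zero_iff` — `g ∈ K a₀ K = K ⟺ g` is integral (`1` clears `g`);
* **`mem_orbit_cellU_one_iff`** — `g ∈ K a₁ K ⟺ ϖ clears g ∧ g ∉ K`.

Mathlib + this seat's file 203 and its imports (p8's T5-134 / T5-136 / T5-187); no display; no device.
§8(d): uses an L-value-free non-vanishing device: NO.
-/

namespace Summit.Ventures.HodgeRepro2.T5InertCartanInvariant

open Summit.Ventures.HodgeRepro2.T5CartanCellsDistinct Summit.Ventures.HodgeRepro2.T5HeckeBasisCells
  Summit.Ventures.HodgeRepro2.T5HermitianThreeElements Summit.Ventures.HodgeRepro2.T5UnitaryGroupForm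
  Summit.Ventures.HodgeRepro2.T5UnitaryHeckeAdjoint Summit.Ventures.HodgeRepro2.T5HeckeCellFiltration
  Summit.Ventures.HodgeRepro2.T5InertDegreePrinted

section Mono

variable {R E : Type*} [CommRing R] [Field E] [Algebra R E] [IsFractionRing R E] {ϖ : R} (hϖ : Irreducible ϖ)

include hϖ in
/-- Clearing is monotone in the power of the uniformiser. -/
theorem clears_zpow_mono {g : Matrix (Fin 3) (Fin 3) E} {l l' : ℕ} (hl : l ≤ l')
    (h : Clears R (algebraMap R E ϖ ^ (l : ℤ)) g) : Clears R (algebraMap R E ϖ ^ (l' : ℤ)) g := by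
  rw [clears_iff] at h ⊢
  intro i j
  have hϖ0 : algebraMap R E ϖ ≠ 0 :=
    (map_ne_zero_iff _ (IsFractionRing.injective R E)).2 hϖ.ne_zero
  have hrew : algebraMap R E ϖ ^ (l' : ℤ) * g i j =
      algebraMap R E ϖ ^ (l' - l) * (algebraMap R E ϖ ^ (l : ℤ) * g i j) := by
    rw [← mul_assoc, ← zpow_natCast, ← zpow_add₀ hϖ0, Nat.cast_sub hl, sub_add_cancel]
  rw [hrew]
  exact IsLocalization.isInteger_mul (isInteger_pow ϖ (l' - l)) (h i j)

end Mono

section Invariant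

variable {R E : Type*} [CommRing R] [Field E] [StarRing E] [Algebra R E] [IsFractionRing R E] [IsDomain R]
  [IsDiscreteValuationRing R] [Finite (IsLocalRing.ResidueField R)]
  (hstar : ∀ x : E, IsLocalization.IsInteger R x → IsLocalization.IsInteger R (star x))
  (u : E) (hsu : star u = u) (hu0 : u ≠ 0) (hu : IsLocalization.IsInteger R u)
  (hu' : IsLocalization.IsInteger R u⁻¹) {ϖ : R} (hϖ : Irreducible ϖ)
  (hs : star (algebraMap R E ϖ) = algebraMap R E ϖ)

include hstar hsu hu0 hu hu' in
/-- **The Cartan invariant**: `g ∈ K aₙ K` iff `ϖⁿ` clears `g` and no smaller power does. -/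
theorem mem_orbit_cellU_iff (g : formUnitaryGroup (J3 u)) (n : ℕ) :
    ((g : formUnitaryGroup (J3 u)) : formUnitaryGroup (J3 u) ⧸ hyperspecialSubgroup R (J3 u)) ∈
        MulAction.orbit (hyperspecialSubgroup R (J3 u))
          ((cellU hϖ hs u n : formUnitaryGroup (J3 u)) :
            formUnitaryGroup (J3 u) ⧸ hyperspecialSubgroup R (J3 u)) ↔
      Clears R (algebraMap R E ϖ ^ (n : ℤ)) ((g : GL (Fin 3) E) : Matrix (Fin 3) (Fin 3) E) ∧
        ∀ l < n, ¬ Clears R (algebraMap R E ϖ ^ (l : ℤ)) ((g : GL (Fin 3) E) : Matrix (Fin 3) (Fin 3) E) := by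
  constructor
  · intro hg
    refine ⟨clears_pow_of_mem_orbit_cellU u hϖ hs hg, fun l hl hcl => ?_⟩
    exact absurd (le_of_clears_pow_of_mem_orbit_cellU u hϖ hs hcl hg) (not_le.2 hl)
  · rintro ⟨hcl, hmin⟩
    obtain ⟨m, hm⟩ := exists_mem_orbit_cellU hstar u hsu hu0 hu hu' hϖ hs g
    rcases (le_of_clears_pow_of_mem_orbit_cellU u hϖ hs hcl hm).lt_or_eq with hlt | rfl
    · exact absurd (clears_pow_of_mem_orbit_cellU u hϖ hs hm) (hmin m hlt)
    · exact hm

include hstar hsu hu0 hu hu' in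
/-- `g ∈ K a_{n+1} K` iff `ϖ^{n+1}` clears `g` and `ϖⁿ` does not. -/
theorem mem_orbit_cellU_succ_iff (g : formUnitaryGroup (J3 u)) (n : ℕ) :
    ((g : formUnitaryGroup (J3 u)) : formUnitaryGroup (J3 u) ⧸ hyperspecialSubgroup R (J3 u)) ∈
        MulAction.orbit (hyperspecialSubgroup R (J3 u))
          ((cellU hϖ hs u (n + 1) : formUnitaryGroup (J3 u)) :
            formUnitaryGroup (J3 u) ⧸ hyperspecialSubgroup R (J3 u)) ↔
      Clears R (algebraMap R E ϖ ^ ((n + 1 : ℕ) : ℤ)) ((g : GL (Fin 3) E) : Matrix (Fin 3) (Fin 3) E) ∧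
        ¬ Clears R (algebraMap R E ϖ ^ (n : ℤ)) ((g : GL (Fin 3) E) : Matrix (Fin 3) (Fin 3) E) := by
  rw [mem_orbit_cellU_iff hstar u hsu hu0 hu hu' hϖ hs]
  refine and_congr_right fun _ => ⟨fun h => h n (Nat.lt_succ_self n), fun h l hl hcl => ?_⟩
  exact h (clears_zpow_mono hϖ (Nat.lt_succ_iff.1 hl) hcl)

include hstar hsu hu0 hu hu' in
/-- `g ∈ K a₀ K = K` iff `g` is integral (`1 = ϖ⁰` clears `g`). -/
theorem mem_orbit_cellU_zero_iff (g : formUnitaryGroup (J3 u)) :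
    ((g : formUnitaryGroup (J3 u)) : formUnitaryGroup (J3 u) ⧸ hyperspecialSubgroup R (J3 u)) ∈
        MulAction.orbit (hyperspecialSubgroup R (J3 u))
          ((cellU hϖ hs u 0 : formUnitaryGroup (J3 u)) :
            formUnitaryGroup (J3 u) ⧸ hyperspecialSubgroup R (J3 u)) ↔
      Clears R (algebraMap R E ϖ ^ ((0 : ℕ) : ℤ)) ((g : GL (Fin 3) E) : Matrix (Fin 3) (Fin 3) E) := by
  rw [mem_orbit_cellU_iff hstar u hsu hu0 hu hu' hϖ hs]
  exact ⟨fun h => h.1, fun h => ⟨h, fun l hl => absurd hl (Nat.not_lt_zero l)⟩⟩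

include hstar hsu hu0 hu hu' in
/-- **`g ∈ K a₁ K` iff `ϖ` clears `g` and `g` is not integral.** -/
theorem mem_orbit_cellU_one_iff (g : formUnitaryGroup (J3 u)) :
    ((g : formUnitaryGroup (J3 u)) : formUnitaryGroup (J3 u) ⧸ hyperspecialSubgroup R (J3 u)) ∈
        MulAction.orbit (hyperspecialSubgroup R (J3 u))
          ((cellU hϖ hs u 1 : formUnitaryGroup (J3 u)) :
            formUnitaryGroup (J3 u) ⧸ hyperspecialSubgroup R (J3 u)) ↔
      Clears R (algebraMap R E ϖ ^ ((1 : ℕ) : ℤ)) ((g : GL (Fin 3) E) : Matrix (Fin 3) (Fin 3) E) ∧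
        ¬ Clears R (algebraMap R E ϖ ^ ((0 : ℕ) : ℤ)) ((g : GL (Fin 3) E) : Matrix (Fin 3) (Fin 3) E) :=
  mem_orbit_cellU_succ_iff hstar u hsu hu0 hu hu' hϖ hs g 0

omit [IsDomain R] [IsDiscreteValuationRing R] [Finite (IsLocalRing.ResidueField R)] in
include hϖ hs in
/-- `g ∈ K a₀ K` iff `g ∈ K`. -/
theorem mem_orbit_cellU_zero_iff_mem (g : formUnitaryGroup (J3 u)) :
    ((g : formUnitaryGroup (J3 u)) : formUnitaryGroup (J3 u) ⧸ hyperspecialSubgroup R (J3 u)) ∈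
        MulAction.orbit (hyperspecialSubgroup R (J3 u))
          ((cellU hϖ hs u 0 : formUnitaryGroup (J3 u)) :
            formUnitaryGroup (J3 u) ⧸ hyperspecialSubgroup R (J3 u)) ↔
      g ∈ hyperspecialSubgroup R (J3 u) := by
  rw [cellU_zero u hϖ hs, MulAction.mem_orbit_iff]
  constructor
  · rintro ⟨κ, hκ⟩
    have hκ' : (((κ : formUnitaryGroup (J3 u)) * 1 : formUnitaryGroup (J3 u)) :
        formUnitaryGroup (J3 u) ⧸ hyperspecialSubgroup R (J3 u)) = ↑g := hκ
    rw [mul_one, QuotientGroup.eq] at hκ'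
    simpa using Subgroup.mul_mem _ κ.2 hκ'
  · intro hg
    refine ⟨⟨g, hg⟩, ?_⟩
    show ((g * 1 : formUnitaryGroup (J3 u)) : formUnitaryGroup (J3 u) ⧸ hyperspecialSubgroup R (J3 u)) = ↑g
    rw [mul_one]

end Invariant

end Summit.Ventures.HodgeRepro2.T5InertCartanInvariant
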